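import Summits.BirchSwinnertonDyer.BirchSwinnertonDyer.Theorems.PrintX8VSInputHondaSystemSprungTowerPoints
import Summits.BirchSwinnertonDyer.Rank1Residual.Additive.KobayashiTowerGeneration
import Summits.BirchSwinnertonDyer.Rank1Residual.Additive.KobayashiLayerLogDescent
import HarnessLib

/-!
# The generation step `E₁(K_m) = ℤ[Γ·c_m] + pE₁(K_m) + E₁(K_{m−1})` and the trace relations
# `Tr_{m+1/m} c_{m+1} − a·c_m + c_{m−1} ∈ E(ℚ_p)` for Sprung's tower points (route `PrintX8VS` / `PrintX8`, support item
# `InputHondaSystem` = stmt-BirchSwinnertonDyer-20413, named fact `Sprung2012.thm22_exists_isHondaSystem`; file 5 of the local series —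
# the general-`a_p` twin of the tree's `Rank1Residual/Additive/KobayashiTowerGeneration`, whose proof it follows line by line)

HONEST FRAMING (desk `pub/bsd-wall/bsd-inputs`, seat `bsd-inputs-honda-p1`, D-0154 (2) INPUTS): THEOREMS ONLY — no definition, no
named fact, no instance, no `sorry`; closes nothing by itself; BSD is not proved by any of this.

## Setting (notation of files 1–4; `Ω = PadicAlgCl p`, `E_Ω = genFibΩ p M`, `L(m)`, `E₁ = kernel`, `Λ = ptLogΩ`, `act` a coordinatewise
## action of `Γ = Gal(ℚ̄_p/ℚ_p)` on `E_Ω`-points)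

All objects are hypotheses (def-free): the Sprung sequence `x` (`x 0 = 1`, `p x 1 = a`, `p x (k+2) = a x (k+1) − x k`, `‖x k‖ ≤ (√p)ᵏ`,
`a ∈ ℤ`), an integral Honda pair `(i, j)` for `log_{F_ss}` (file 3: `i(0) = j(0) = 0`, `i ∘ j = X`, `log_E ∘ i = log_{F_ss}`), and tower
points `c` (file 4: `c m ∈ L(m) ∩ E₁`, `Λ(c m) = ℓ_m`).

* §1 `exists_closure_pt_sprung`: every `z ∈ ℤ[Γ·ζ_m]` is `Λ(B)` modulo `layer (m−1)` for some `B ∈ ℤ[Γ·c_m] ⊆ L(m) ∩ E₁`.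
* §2 **`exists_sub_closure_sub_smul_mem_sprung`** (Kobayashi Prop. 8.11 ⇒ 8.12 ii) step / Sprung Lemmas 7.4–7.5 in generation form):
  for `m ≥ 1`, `p` odd and `P ∈ L(m) ∩ E₁` there are `B ∈ ℤ[Γ·c_m]` and `R ∈ L(m) ∩ E₁` with `P − B − p•R ∈ L(m−1)` — given no
  `p`-power torsion in `L(m)`. Inputs: `Λ(E₁(K_m)) ⊆ K_{m−1} + 𝒪_m` (Honda pair + congruence form of `log_{F_ss}`, files 2–3),
  `𝒪_m ⊆ ℤ[Γ·ζ_m] + K_{m−1} + p³𝒪_m` (tree `PadicCyclotomicIntegers`), `p³𝒪_m ⊆ Λ(p·E₁)` (tree `exists_ptLog_eq`), §1.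
* §3 **trace relations as points**: `(∑_{q ∈ stab m/stab (m+1)} act q̃ c_{m+1}) − a•c_m + c_{m−1} ∈ L(0) = E(ℚ_p)` (`m ≥ 1`) and
  `∑_{q ∈ Γ/stab 1} act q̃ c_1 ∈ L(0)` (their logarithms are `−p`; file 4's trace identity), given no `p`-power torsion in `L(m+1)`.

References: [Kobayashi2003] S. Kobayashi, Invent. Math. 152 (2003), Lemma 8.9, Prop. 8.11, Prop. 8.12; [Sprung2012] F. Sprung,
J. Number Theory 132 (2012), Thm. 2.2, Cor. 2.10, Lemmas 7.4–7.5.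
-/

set_option autoImplicit false
-- the Theorems namespace of this sub repeats the summit name by design (D-0017 nested layout)
set_option linter.dupNamespace false

noncomputable section

open scoped Classical Topology NNReal
open Filter PowerSeries Finset

namespace Summit.BirchSwinnertonDyer.BirchSwinnertonDyer.Theorems

namespace SprungHonda

open Summit.BirchSwinnertonDyer.Rank1Residual.Additive Summit.BirchSwinnertonDyer.Rank1Residual.Additive.BallEval
open Summit.BirchSwinnertonDyer.Rank1Residual.Additive.PadicCyclotomicTower
open Literature.NumberTheory.GaloisRepresentations.LubinTate (unitBall)
open Literature.NumberTheory.EllipticCurves.FormalGroupChart (kernel val_zCoord_lt_one)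
open WeierstrassCurve

variable {p : ℕ} [hp : Fact p.Prime] {M : WeierstrassCurve ℤ_[p]} [hE : (M.map PadicInt.Coe.ringHom).IsElliptic]
variable [hintΩ : (genFibΩ p M).IsIntegral (Valued.v (R := PadicAlgCl p)).integer]

/-! ## §1 The closure correspondence -/

/-- **The closure correspondence**: if `Λ(c) = ℓ_m` with `ℓ_m − (ζ_m − 1) ∈ layer (m−1)` and `c ∈ L(m) ∩ E₁`, then every
`z ∈ ℤ[Γ·ζ_m]` is `Λ(B)` modulo `layer (m−1)` for some `B ∈ ℤ[Γ·c] ⊆ L(m) ∩ E₁`. [cite: Kobayashi2003, Prop. 8.11] -/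
theorem exists_closure_pt_sprung
    (act : Field.absoluteGaloisGroup ℚ_[p] → (genFibΩ p M).toAffine.Point → (genFibΩ p M).toAffine.Point)
    (hact0 : ∀ σ, act σ 0 = 0)
    (hact : ∀ σ (x y : PadicAlgCl p) (h : (genFibΩ p M).toAffine.Nonsingular x y),
      ∃ h', act σ (Affine.Point.some x y h) = Affine.Point.some (σ • x) (σ • y) h')
    {m : ℕ} {c : (genFibΩ p M).toAffine.Point}
    (hcL : c ∈ subfieldPoints (genFibΩ p M) (layer p m).toSubfield coeffs_mem_layer)
    (hck : c ∈ kernel (Valued.v (R := PadicAlgCl p)) (genFibΩ p M))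
    {ℓ : PadicAlgCl p} (hcΛ : ptLogΩ p M c = ℓ) (hℓ : ℓ - (zeta p m - 1) ∈ layer p (m - 1))
    {z : PadicAlgCl p}
    (hz : z ∈ AddSubgroup.closure (Set.range fun σ : Field.absoluteGaloisGroup ℚ_[p] ↦ σ • zeta p m)) :
    ∃ B ∈ AddSubgroup.closure (Set.range fun σ : Field.absoluteGaloisGroup ℚ_[p] ↦ act σ c),
      B ∈ subfieldPoints (genFibΩ p M) (layer p m).toSubfield coeffs_mem_layer ∧
      B ∈ kernel (Valued.v (R := PadicAlgCl p)) (genFibΩ p M) ∧ ptLogΩ p M B - z ∈ layer p (m - 1) := by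
  haveI := isIntegral_curveK p (LayerField p m) M
  have hcz : ‖c.zCoord‖ < 1 := by
    have := val_zCoord_lt_one hck
    rwa [PadicAlgCl.valuation_def, ← NNReal.coe_lt_coe, coe_nnnorm, NNReal.coe_one] at this
  induction hz using AddSubgroup.closure_induction with
  | mem x hx =>
    obtain ⟨σ, rfl⟩ := hx
    refine ⟨act σ c, AddSubgroup.subset_closure ⟨σ, rfl⟩,
      act_mem_subfieldPoints act hact0 hact σ hcL, act_mem_kernel act hact0 hact σ hck, ?_⟩
    rw [ptLogΩ_act act hact0 hact σ hcz, hcΛ]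
    have e : σ • ℓ - σ • zeta p m = σ • (ℓ - (zeta p m - 1)) - 1 := by
      rw [smul_sub, smul_sub, smul_one]; ring
    change σ • ℓ - σ • zeta p m ∈ layer p (m - 1)
    rw [e]
    exact IntermediateField.sub_mem _ (smul_mem_layer σ hℓ) (IntermediateField.one_mem _)
  | zero =>
    refine ⟨0, AddSubgroup.zero_mem _, (subfieldPoints _ _ _).zero_mem,
      (kernel (Valued.v (R := PadicAlgCl p)) (genFibΩ p M)).zero_mem, ?_⟩
    rw [ptLogΩ_zero, sub_zero]; exact IntermediateField.zero_mem _
  | add u v _ _ ihu ihv =>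
    obtain ⟨B₁, hB₁, hB₁L, hB₁k, h₁⟩ := ihu
    obtain ⟨B₂, hB₂, hB₂L, hB₂k, h₂⟩ := ihv
    refine ⟨B₁ + B₂, AddSubgroup.add_mem _ hB₁ hB₂, (subfieldPoints _ _ _).add_mem hB₁L hB₂L,
      (kernel (Valued.v (R := PadicAlgCl p)) (genFibΩ p M)).add_mem hB₁k hB₂k, ?_⟩
    rw [ptLogΩ_add (m := m) hB₁L hB₂L hB₁k hB₂k]
    have e : ptLogΩ p M B₁ + ptLogΩ p M B₂ - (u + v) = (ptLogΩ p M B₁ - u) + (ptLogΩ p M B₂ - v) := by ring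
    rw [e]; exact IntermediateField.add_mem _ h₁ h₂
  | neg u _ ih =>
    obtain ⟨B, hB, hBL, hBk, h⟩ := ih
    refine ⟨-B, AddSubgroup.neg_mem _ hB, (subfieldPoints _ _ _).neg_mem hBL,
      (kernel (Valued.v (R := PadicAlgCl p)) (genFibΩ p M)).neg_mem hBk, ?_⟩
    have hneg : ptLogΩ p M (-B) = -ptLogΩ p M B := by
      have h0 := ptLogΩ_sub (m := m) (subfieldPoints _ _ _).zero_mem hBL
        (kernel (Valued.v (R := PadicAlgCl p)) (genFibΩ p M)).zero_mem hBk
      rw [zero_sub, ptLogΩ_zero, zero_sub] at h0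
      exact h0
    rw [hneg]
    have e : -ptLogΩ p M B - -u = -(ptLogΩ p M B - u) := by ring
    rw [e]; exact IntermediateField.neg_mem _ h

/-! ## §2 The generation step -/

/-- The subfield `K_{m−1} ⊆ K_m = LayerField p m` contains `ℚ_p`. [folklore] -/
theorem algebraMap_mem_comap_layer (m m' : ℕ) (q : ℚ_[p]) :
    algebraMap ℚ_[p] (LayerField p m) q ∈ Subfield.comap (LayerField.emb p m).toRingHom (layer p m').toSubfield := by
  change LayerField.emb p m (algebraMap ℚ_[p] (LayerField p m) q) ∈ (layer p m').toSubfield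
  rw [AlgHom.commutes]
  exact (layer p m').algebraMap_mem q

/-- **The generation step** (Kobayashi Prop. 8.11 ⇒ Prop. 8.12 ii) for Sprung's points): for `m ≥ 1`, `p` odd, a tower point
`c ∈ L(m) ∩ E₁` with `Λ(c) = ℓ_m`, `ℓ_m − (ζ_m − 1) ∈ layer (m−1)`, an integral Honda pair `(i, j)` for the Sprung logarithm, and
`P ∈ L(m) ∩ E₁`, there are `B ∈ ℤ[Γ·c]` and `R ∈ L(m) ∩ E₁` with `P − B − p•R ∈ L(m−1)` — provided `L(m)` has no `p`-power torsion.
[cite: Kobayashi2003, Prop. 8.11 and Prop. 8.12] [cite: Sprung2012, Lemmas 7.4–7.5] -/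
theorem exists_sub_closure_sub_smul_mem_sprung (hp2 : p ≠ 2) {x : ℕ → ℚ_[p]} (hxb : ∀ k, ‖x k‖ ≤ Real.sqrt p ^ k)
    {i j : ℤ_[p]⟦X⟧} (hi0 : constantCoeff i = 0) (hj0 : constantCoeff j = 0) (hij : i.subst j = X)
    (hlog : (M.map (PadicInt.Coe.ringHom (p := p))).formalLog.subst (i.map PadicInt.Coe.ringHom) =
      PowerSeries.mk fun d ↦ ∑' k : ℕ, x k * (((p ^ k).choose d : ℚ_[p]) - if d = 0 then 1 else 0))
    (act : Field.absoluteGaloisGroup ℚ_[p] → (genFibΩ p M).toAffine.Point → (genFibΩ p M).toAffine.Point)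
    (hact0 : ∀ σ, act σ 0 = 0)
    (hact : ∀ σ (x y : PadicAlgCl p) (h : (genFibΩ p M).toAffine.Nonsingular x y),
      ∃ h', act σ (Affine.Point.some x y h) = Affine.Point.some (σ • x) (σ • y) h')
    {m : ℕ} (hm : 1 ≤ m)
    (htors : ∀ Q ∈ subfieldPoints (genFibΩ p M) (layer p m).toSubfield coeffs_mem_layer, ∀ k : ℕ, p ^ k • Q = 0 → Q = 0)
    {c : (genFibΩ p M).toAffine.Point}
    (hcL : c ∈ subfieldPoints (genFibΩ p M) (layer p m).toSubfield coeffs_mem_layer)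
    (hck : c ∈ kernel (Valued.v (R := PadicAlgCl p)) (genFibΩ p M))
    (hcΛ : ptLogΩ p M c = ∑ k ∈ range m, algebraMap ℚ_[p] (PadicAlgCl p) (x k) * (zeta p (m - k) - 1))
    (hx0 : x 0 = 1)
    {P : (genFibΩ p M).toAffine.Point} (hP : P ∈ subfieldPoints (genFibΩ p M) (layer p m).toSubfield coeffs_mem_layer)
    (hPk : P ∈ kernel (Valued.v (R := PadicAlgCl p)) (genFibΩ p M)) :
    ∃ B ∈ AddSubgroup.closure (Set.range fun σ : Field.absoluteGaloisGroup ℚ_[p] ↦ act σ c),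
      ∃ R ∈ subfieldPoints (genFibΩ p M) (layer p m).toSubfield coeffs_mem_layer,
        R ∈ kernel (Valued.v (R := PadicAlgCl p)) (genFibΩ p M) ∧
        P - B - p • R ∈ subfieldPoints (genFibΩ p M) (layer p (m - 1)).toSubfield coeffs_mem_layer := by
  haveI := isIntegral_curveK p (LayerField p m) M
  -- lift `P` to `K = K_m`
  obtain ⟨PK, rfl⟩ := exists_toOmega_eq hP
  have hPKk : PK ∈ kernel (NormedField.valuation (K := LayerField p m)) (curveK p (LayerField p m) M) :=
    (toOmega_mem_kernel_iff PK).mp hPk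
  -- (BR1): `Λ(P) = μ₀ + y`, `μ₀ ∈ K_{m−1}`, `‖y‖ ≤ 1`
  set K' : Subfield (LayerField p m) := Subfield.comap (LayerField.emb p m).toRingHom (layer p (m - 1)).toSubfield with hK'
  have hcongr : ∀ y : LayerField p m, ‖y‖ < 1 → ∃ μ ∈ K', ‖qEval p (LayerField p m)
      (PowerSeries.mk fun d ↦ ∑' k : ℕ, x k * (((p ^ k).choose d : ℚ_[p]) - if d = 0 then 1 else 0)) y - μ‖ ≤ 1 :=
    fun y hy ↦ exists_mem_norm_qEval_sprungLog_sub_le_one hxb K' (algebraMap_mem_comap_layer m (m - 1))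
      (frob_layerField hp2 hm) hy
  obtain ⟨μ₀, hμ₀, hμ₀y⟩ := exists_mem_norm_ptLog_sub_le_one_of_forall hi0 hj0 hij hlog K' hcongr hPKk
  set y : LayerField p m := ptLog p (LayerField p m) M PK - μ₀ with hy
  have hμ₀L : LayerField.emb p m μ₀ ∈ layer p (m - 1) := hμ₀
  -- (DEC): `emb y − p³ y'Ω ∈ ℤ[Γ·ζ_m] + layer (m−1)`
  obtain ⟨y'Ω, hy'L, hy'1, hdec⟩ := exists_sub_pow_mul_mem_closure_sup p hm (LayerField.emb_mem y)
    (by rw [LayerField.norm_emb]; exact hμ₀y) 3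
  obtain ⟨z, hz, ν, hν, hzν⟩ := AddSubgroup.mem_sup.mp hdec
  have hνL : ν ∈ layer p (m - 1) := hν
  -- local surjectivity: `p³ y' = Λ(p • RK)`
  set y'K : LayerField p m := LayerField.mk p m y'Ω hy'L with hy'K
  have hp1 : ‖(p : LayerField p m)‖ = (p : ℝ)⁻¹ := by
    rw [← LayerField.norm_emb, map_natCast, ← map_natCast (algebraMap ℚ_[p] (PadicAlgCl p)) p]
    exact (PadicAlgCl.norm_extends (p := p) (p : ℚ_[p])).trans Padic.norm_p
  have htarget : ‖(p : LayerField p m) ^ 2 * y'K‖ ≤ 1 / 4 := by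
    rw [norm_mul, norm_pow, hp1]
    have hy'n : ‖y'K‖ ≤ 1 := by rw [hy'K, ← LayerField.norm_emb, LayerField.emb_mk]; exact hy'1
    have hp2' : (2 : ℝ) ≤ p := by exact_mod_cast hp.out.two_le
    have hinv : (p : ℝ)⁻¹ ≤ 1 / 2 := by rw [one_div]; exact inv_anti₀ two_pos hp2'
    calc (p : ℝ)⁻¹ ^ 2 * ‖y'K‖ ≤ (1 / 2) ^ 2 * 1 :=
          mul_le_mul (pow_le_pow_left₀ (by positivity) hinv 2) hy'n (norm_nonneg _) (by positivity)
      _ = 1 / 4 := by norm_num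
  obtain ⟨RK, hRKk, hΛR, -⟩ := exists_ptLog_eq (p := p) (M := M) htarget
  have hΛpR : ptLog p (LayerField p m) M (p • RK) = (p : LayerField p m) ^ 3 * y'K := by
    rw [ptLog_nsmul hRKk, hΛR]; ring
  -- the `Γ`-combination of conjugates of `c`
  obtain ⟨B, hB, hBL, hBk, hBz⟩ := exists_closure_pt_sprung act hact0 hact hcL hck hcΛ
    (sprungEll_sub_mem_layer_pred hx0 hm) hz
  set νB := ptLogΩ p M B - z with hνB
  -- assemble
  refine ⟨B, hB, toOmega p M m RK, toOmega_mem_subfieldPoints _, (toOmega_mem_kernel_iff RK).mpr hRKk, ?_⟩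
  have hPRL : toOmega p M m PK - B - p • toOmega p M m RK ∈
      subfieldPoints (genFibΩ p M) (layer p m).toSubfield coeffs_mem_layer :=
    (subfieldPoints _ _ _).sub_mem ((subfieldPoints _ _ _).sub_mem (toOmega_mem_subfieldPoints _) hBL)
      ((subfieldPoints _ _ _).nsmul_mem (toOmega_mem_subfieldPoints _) _)
  have hpRk : p • toOmega p M m RK ∈ kernel (Valued.v (R := PadicAlgCl p)) (genFibΩ p M) :=
    (kernel (Valued.v (R := PadicAlgCl p)) (genFibΩ p M)).nsmul_mem ((toOmega_mem_kernel_iff RK).mpr hRKk) _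
  have hPRk : toOmega p M m PK - B - p • toOmega p M m RK ∈ kernel (Valued.v (R := PadicAlgCl p)) (genFibΩ p M) :=
    (kernel (Valued.v (R := PadicAlgCl p)) (genFibΩ p M)).sub_mem
      ((kernel (Valued.v (R := PadicAlgCl p)) (genFibΩ p M)).sub_mem hPk hBk) hpRk
  refine mem_subfieldPoints_of_ptLogΩ_mem act hact0 hact htors hPRL hPRk ?_
  -- the logarithm of `P − B − p•R`
  have hΛP : ptLogΩ p M (toOmega p M m PK) = LayerField.emb p m μ₀ + LayerField.emb p m y := by
    rw [ptLogΩ_toOmega hPKk, hy, ← map_add]; congr 1; ring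
  have hΛpR' : ptLogΩ p M (p • toOmega p M m RK) = (p : PadicAlgCl p) ^ 3 * y'Ω := by
    rw [← map_nsmul, ptLogΩ_toOmega ((kernel (NormedField.valuation (K := LayerField p m))
      (curveK p (LayerField p m) M)).nsmul_mem hRKk _), hΛpR, map_mul, map_pow, map_natCast, hy'K, LayerField.emb_mk]
  rw [ptLogΩ_sub (m := m) ((subfieldPoints _ _ _).sub_mem (toOmega_mem_subfieldPoints _) hBL)
      ((subfieldPoints _ _ _).nsmul_mem (toOmega_mem_subfieldPoints _) _)
      ((kernel (Valued.v (R := PadicAlgCl p)) (genFibΩ p M)).sub_mem hPk hBk) hpRk,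
    ptLogΩ_sub (m := m) (toOmega_mem_subfieldPoints _) hBL hPk hBk, hΛP, hΛpR']
  have eB : ptLogΩ p M B = z + νB := by rw [hνB]; ring
  rw [eB]
  have e : LayerField.emb p m μ₀ + LayerField.emb p m y - (z + νB) - (p : PadicAlgCl p) ^ 3 * y'Ω =
      LayerField.emb p m μ₀ + ν - νB + (LayerField.emb p m y - (p : PadicAlgCl p) ^ 3 * y'Ω - (z + ν)) := by ring
  rw [e, hzν, sub_self, add_zero]
  exact IntermediateField.sub_mem _ (IntermediateField.add_mem _ hμ₀L hνL) hBz

/-! ## §3 The trace relations as points of `E(ℚ_p)` -/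

/-- **The trace relation of Sprung's Thm. 2.2 (1) / [K] Lemma 8.9 as a point statement** (`m ≥ 1`): for tower points `c` with
`Λ(c n) = ℓ_n`, `(∑_{q ∈ stab m / stab (m+1)} act q̃ (c (m+1))) − a•(c m) + c (m−1)` has logarithm `−p`, hence lies in
`L(0) = E(ℚ_p)` (given no `p`-power torsion in `L(m+1)`). [cite: Sprung2012, Thm. 2.2 (1)] [cite: Kobayashi2003, Lemma 8.9] -/
theorem sum_act_sub_smul_add_mem_sprung {a : ℤ} {x : ℕ → ℚ_[p]} (hx0 : x 0 = 1) (hx1 : (p : ℚ_[p]) * x 1 = a)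
    (hrec : ∀ k, (p : ℚ_[p]) * x (k + 2) = a * x (k + 1) - x k)
    (act : Field.absoluteGaloisGroup ℚ_[p] → (genFibΩ p M).toAffine.Point → (genFibΩ p M).toAffine.Point)
    (hact0 : ∀ σ, act σ 0 = 0)
    (hact : ∀ σ (x y : PadicAlgCl p) (h : (genFibΩ p M).toAffine.Nonsingular x y),
      ∃ h', act σ (Affine.Point.some x y h) = Affine.Point.some (σ • x) (σ • y) h')
    {c : ℕ → (genFibΩ p M).toAffine.Point}
    (hcL : ∀ n, c n ∈ subfieldPoints (genFibΩ p M) (layer p n).toSubfield coeffs_mem_layer)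
    (hck : ∀ n, c n ∈ kernel (Valued.v (R := PadicAlgCl p)) (genFibΩ p M))
    (hcΛ : ∀ n, ptLogΩ p M (c n) = ∑ k ∈ range n, algebraMap ℚ_[p] (PadicAlgCl p) (x k) * (zeta p (n - k) - 1))
    {m : ℕ} (hm : 1 ≤ m)
    [Fintype (stab p m ⧸ (stab p (m + 1)).subgroupOf (stab p m))]
    (htors : ∀ Q ∈ subfieldPoints (genFibΩ p M) (layer p (m + 1)).toSubfield coeffs_mem_layer,
      ∀ k : ℕ, p ^ k • Q = 0 → Q = 0) :
    (∑ q : stab p m ⧸ (stab p (m + 1)).subgroupOf (stab p m),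
        act ((q.out : stab p m) : Field.absoluteGaloisGroup ℚ_[p]) (c (m + 1))) - a • c m + c (m - 1) ∈
      subfieldPoints (genFibΩ p M) (layer p 0).toSubfield coeffs_mem_layer := by
  haveI := isIntegral_curveK p (LayerField p (m + 1)) M
  have hcz : ‖(c (m + 1)).zCoord‖ < 1 := by
    have := val_zCoord_lt_one (hck (m + 1))
    rwa [PadicAlgCl.valuation_def, ← NNReal.coe_lt_coe, coe_nnnorm, NNReal.coe_one] at this
  have hSL : (∑ q : stab p m ⧸ (stab p (m + 1)).subgroupOf (stab p m),
      act ((q.out : stab p m) : Field.absoluteGaloisGroup ℚ_[p]) (c (m + 1))) ∈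
      subfieldPoints (genFibΩ p M) (layer p (m + 1)).toSubfield coeffs_mem_layer :=
    (subfieldPoints _ _ _).sum_mem fun q _ ↦ act_mem_subfieldPoints act hact0 hact _ (hcL (m + 1))
  have hSk : (∑ q : stab p m ⧸ (stab p (m + 1)).subgroupOf (stab p m),
      act ((q.out : stab p m) : Field.absoluteGaloisGroup ℚ_[p]) (c (m + 1))) ∈
      kernel (Valued.v (R := PadicAlgCl p)) (genFibΩ p M) :=
    (kernel (Valued.v (R := PadicAlgCl p)) (genFibΩ p M)).sum_mem fun q _ ↦ act_mem_kernel act hact0 hact _ (hck (m + 1))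
  have hcmL : a • c m ∈ subfieldPoints (genFibΩ p M) (layer p (m + 1)).toSubfield coeffs_mem_layer :=
    (subfieldPoints _ _ _).zsmul_mem (subfieldPoints_layer_mono (Nat.le_succ m) (hcL m)) _
  have hcmk : a • c m ∈ kernel (Valued.v (R := PadicAlgCl p)) (genFibΩ p M) :=
    (kernel (Valued.v (R := PadicAlgCl p)) (genFibΩ p M)).zsmul_mem (hck m) _
  have hc'L : c (m - 1) ∈ subfieldPoints (genFibΩ p M) (layer p (m + 1)).toSubfield coeffs_mem_layer :=
    subfieldPoints_layer_mono (by omega) (hcL (m - 1))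
  refine mem_subfieldPoints_of_ptLogΩ_mem act hact0 hact htors
    ((subfieldPoints _ _ _).add_mem ((subfieldPoints _ _ _).sub_mem hSL hcmL) hc'L)
    ((kernel (Valued.v (R := PadicAlgCl p)) (genFibΩ p M)).add_mem
      ((kernel (Valued.v (R := PadicAlgCl p)) (genFibΩ p M)).sub_mem hSk hcmk) (hck (m - 1))) ?_
  rw [ptLogΩ_add (m := m + 1) ((subfieldPoints _ _ _).sub_mem hSL hcmL) hc'L
      ((kernel (Valued.v (R := PadicAlgCl p)) (genFibΩ p M)).sub_mem hSk hcmk) (hck (m - 1)),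
    ptLogΩ_sub (m := m + 1) hSL hcmL hSk hcmk,
    ptLogΩ_zsmul (m := m) (hcL m) (hck m),
    ptLogΩ_finset_sum (m := m + 1) _ _ (fun q _ ↦ act_mem_subfieldPoints act hact0 hact _ (hcL (m + 1)))
      (fun q _ ↦ act_mem_kernel act hact0 hact _ (hck (m + 1)))]
  simp_rw [ptLogΩ_act act hact0 hact _ hcz, hcΛ]
  rw [sum_smul_sprungEll_succ hx0 hx1 hrec hm]
  have e : -(p : PadicAlgCl p) + (a : PadicAlgCl p) * ∑ k ∈ range m, algebraMap ℚ_[p] (PadicAlgCl p) (x k) * (zeta p (m - k) - 1) -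
        ∑ k ∈ range (m - 1), algebraMap ℚ_[p] (PadicAlgCl p) (x k) * (zeta p (m - 1 - k) - 1) -
        (a : ℤ) * ∑ k ∈ range m, algebraMap ℚ_[p] (PadicAlgCl p) (x k) * (zeta p (m - k) - 1) +
        ∑ k ∈ range (m - 1), algebraMap ℚ_[p] (PadicAlgCl p) (x k) * (zeta p (m - 1 - k) - 1) = -(p : PadicAlgCl p) := by
    ring
  rw [e]
  exact IntermediateField.neg_mem _ (by exact_mod_cast IntermediateField.natCast_mem (layer p 0) p)

/-- **The trace relation at the bottom** (Sprung's Thm. 2.2 (2) shape): `∑_{q ∈ Γ / stab 1} act q̃ (c 1) ∈ L(0) = E(ℚ_p)` (its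
logarithm is `−p`), given no `p`-power torsion in `L(1)`. [cite: Sprung2012, Thm. 2.2 (2)] [cite: Kobayashi2003, Lemma 8.9] -/
theorem sum_act_one_mem_sprung {x : ℕ → ℚ_[p]} (hx0 : x 0 = 1)
    (act : Field.absoluteGaloisGroup ℚ_[p] → (genFibΩ p M).toAffine.Point → (genFibΩ p M).toAffine.Point)
    (hact0 : ∀ σ, act σ 0 = 0)
    (hact : ∀ σ (x y : PadicAlgCl p) (h : (genFibΩ p M).toAffine.Nonsingular x y),
      ∃ h', act σ (Affine.Point.some x y h) = Affine.Point.some (σ • x) (σ • y) h')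
    {c : ℕ → (genFibΩ p M).toAffine.Point}
    (hcL : ∀ n, c n ∈ subfieldPoints (genFibΩ p M) (layer p n).toSubfield coeffs_mem_layer)
    (hck : ∀ n, c n ∈ kernel (Valued.v (R := PadicAlgCl p)) (genFibΩ p M))
    (hcΛ : ∀ n, ptLogΩ p M (c n) = ∑ k ∈ range n, algebraMap ℚ_[p] (PadicAlgCl p) (x k) * (zeta p (n - k) - 1))
    [Fintype (stab p 0 ⧸ (stab p 1).subgroupOf (stab p 0))]
    (htors : ∀ Q ∈ subfieldPoints (genFibΩ p M) (layer p 1).toSubfield coeffs_mem_layer, ∀ k : ℕ, p ^ k • Q = 0 → Q = 0) :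
    (∑ q : stab p 0 ⧸ (stab p 1).subgroupOf (stab p 0),
        act ((q.out : stab p 0) : Field.absoluteGaloisGroup ℚ_[p]) (c 1)) ∈
      subfieldPoints (genFibΩ p M) (layer p 0).toSubfield coeffs_mem_layer := by
  haveI := isIntegral_curveK p (LayerField p 1) M
  have hcz : ‖(c 1).zCoord‖ < 1 := by
    have := val_zCoord_lt_one (hck 1)
    rwa [PadicAlgCl.valuation_def, ← NNReal.coe_lt_coe, coe_nnnorm, NNReal.coe_one] at this
  have hSL : (∑ q : stab p 0 ⧸ (stab p 1).subgroupOf (stab p 0),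
      act ((q.out : stab p 0) : Field.absoluteGaloisGroup ℚ_[p]) (c 1)) ∈
      subfieldPoints (genFibΩ p M) (layer p 1).toSubfield coeffs_mem_layer :=
    (subfieldPoints _ _ _).sum_mem fun q _ ↦ act_mem_subfieldPoints act hact0 hact _ (hcL 1)
  have hSk : (∑ q : stab p 0 ⧸ (stab p 1).subgroupOf (stab p 0),
      act ((q.out : stab p 0) : Field.absoluteGaloisGroup ℚ_[p]) (c 1)) ∈
      kernel (Valued.v (R := PadicAlgCl p)) (genFibΩ p M) :=
    (kernel (Valued.v (R := PadicAlgCl p)) (genFibΩ p M)).sum_mem fun q _ ↦ act_mem_kernel act hact0 hact _ (hck 1)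
  refine mem_subfieldPoints_of_ptLogΩ_mem act hact0 hact htors hSL hSk ?_
  rw [ptLogΩ_finset_sum (m := 1) _ _ (fun q _ ↦ act_mem_subfieldPoints act hact0 hact _ (hcL 1))
      (fun q _ ↦ act_mem_kernel act hact0 hact _ (hck 1))]
  simp_rw [ptLogΩ_act act hact0 hact _ hcz, hcΛ]
  rw [sum_smul_sprungEll_one hx0]
  exact IntermediateField.neg_mem _ (by exact_mod_cast IntermediateField.natCast_mem (layer p 0) p)

end SprungHonda

end Summit.BirchSwinnertonDyer.BirchSwinnertonDyer.Theorems

end
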